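import Mathlib
import Summits.QuantumFields.YangMills.Theses.DirichletWindow
import Summits.QuantumFields.YangMills.Theorems.ConvexGribovBodyContinuumLegGivenGapDock
import Summits.QuantumFields.YangMills.Theorems.ConvexGribovBodyContinuumLegGivenGapStubWitness
import Summits.QuantumFields.YangMills.Theorems.ConvexGribovBodyContinuumLegGivenGapStubLockOfRpCore
import Summits.QuantumFields.YangMills.Theorems.ConvexGribovBodyContinuumLegGivenGapStubRpCore
import Summits.QuantumFields.YangMills.Theorems.ConvexGribovBodyContinuumLegGivenGapStubArp
import Summits.QuantumFields.YangMills.Theorems.ParabolicTrajectoryContinuumLimitOnTrajectoryStubArp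
import Summits.QuantumFields.YangMills.Theorems.ParabolicTrajectoryContinuumLimitOnTrajectoryUvbOfUuvb
import Summits.QuantumFields.YangMills.Theorems.ParabolicTrajectoryContinuumLimitOnTrajectorySlabRP
import Literature.Barriers.QuantumFields.UVStabilityNonUniqueness
import Literature.MathematicalPhysics.QuantumFieldTheory.MassGapFromLatticeClustering
import HarnessLib

/-!
# `ContinuumLegGivenGap` (stmt-QuantumFields-15828), line `Sketch`: split glue, part B — the IR lock, the lattice gap, the skewness floor, sub-schemes

Part B of the DEF-FREE Theorems rendering of the composition of line `Sketch` (reshape 18d; see part A,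
`…ComplexCouplingChannelContinuumLegGivenGapSplitA`): (i) the locked IR datum from the crux's per-β torus clustering
at one `(G, r)` under `XiDiverges` — the LANDED reflection-positivity core `stub_rpCore` (p135996) fed to the landed
`stub_lockOfRpCore` (p135366); (ii) the volume-uniform lattice gap of a scheme built on locked data
(`hasLatticeMassGap_of_uniformClustering`); (iii) the skewness floor FREQUENTLY in `k` from the NLO skewness window —
the registered open stub `stub_skewWindow` taken as an explicit HYPOTHESIS, verbatim — via the landed first lemma
`stub_witness` (p121579); (iv) transport of route ParabolicTrajectory's one-field inputs (`UVB`, `ARP`, `ND2`, `UCL`,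
`AsympEuclid`) and of Cauchy–Schwarz clustering to sub-schemes (Literature `subScheme`; PT's landed `uvb_of_uuvb`,
`stub_arp`, `torusSlabRP_of_tendsto`). All functionals are `curvDistribution r sch`. No definitions, no facts, no
`sorry`. [folklore]
-/

noncomputable section

namespace Summit.QuantumFields.YangMills.Theorems.ContinuumLegGivenGap

open scoped SchwartzMap
open Filter Topology MeasureTheory
open Literature.MathematicalPhysics.QuantumFieldTheory Literature.MathematicalPhysics.QuantumLattice
  Literature.MathematicalPhysics.AQFT Literature.Probability.LatticeModels
open Literature.Barriers.QuantumFields (subScheme hasLatticeMassGap_subScheme)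
open Summit.QuantumFields.YangMills.Theses
open Summit.QuantumFields.YangMills.Cruxes.ContinuumLimitOnTrajectory.TwoOrbitSynchronisation
  (curvDistribution canon UUVB UVB ARP ND2 ND3 UCL AsympEuclid AsympTransl AsympRot torusSlabRP_of_tendsto)

variable {G : Type} [Group G] [TopologicalSpace G] [IsTopologicalGroup G] [CompactSpace G]
  [MeasurableSpace G] [BorelSpace G]

/-- Route ParabolicTrajectory's E0′ bound (its `UVB`, on `curvDistribution`). -/
local notation "PT_UVB" => Summit.QuantumFields.YangMills.Cruxes.ContinuumLimitOnTrajectory.TwoOrbitSynchronisation.UVB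
/-- Route ParabolicTrajectory's approximate reflection positivity (its `ARP`, on `curvDistribution`). -/
local notation "PT_ARP" => Summit.QuantumFields.YangMills.Cruxes.ContinuumLimitOnTrajectory.TwoOrbitSynchronisation.ARP

omit [Group G] [TopologicalSpace G] [IsTopologicalGroup G] [CompactSpace G] [MeasurableSpace G] [BorelSpace G] in
/-- Anchor (registered sub-goal of stmt-QuantumFields-15828 for this file): the clustering exponential is monotone in the
rate at non-negative times. [folklore] -/
theorem cclgSplit_exp_mono : ∀ (Δ Δ' t : ℝ), Δ' ≤ Δ → 0 ≤ t → Real.exp (-Δ * t) ≤ Real.exp (-Δ' * t) :=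
  fun _ _ _ hΔ ht => Real.exp_le_exp.2 (by nlinarith)

/-! ## (i) The IR lock from the reflection-positivity core -/

/-- **The locked IR datum** (`locked_of_core` of line `Sketch`): under `XiDiverges`, at a compact simple `(G, r)` with
the crux's per-β torus clustering, there are couplings `β_k → ∞`, rates `m̂_k > 0`, pair-free thresholds and `K > 0`
with one constant per pair for all `k` (UNIFORM) and no volume-uniform clustering at rate `K m̂_k` (SHARP) — the landed
`stub_lockOfRpCore` applied to the landed `stub_rpCore`. [folklore] -/
theorem cclgSplit_locked_of_core (hXi : DirichletWindow.XiDiverges) (hG : IsCompactSimpleLieGroup G)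
    (r : LatticeRep G)
    (hGap : (∃ β₀ : ℝ, ∀ β : ℝ, β₀ ≤ β → ∃ m : ℝ, 0 < m ∧ ∃ S₁ : ℕ, ∀ A B : YMSpecies G, ∃ C : ℝ,
        ∀ S n : ℕ, S₁ ≤ S → n ≤ S →
          |latticeConnectedCorr r.ρ β (2 * S + 1) A.F B.F n| ≤ C * Real.exp (-(m * n)))) :
    ∃ (β : ℕ → ℝ) (mh : ℕ → ℝ) (S₁ : ℕ → ℕ) (K : ℝ),
      (Tendsto β atTop atTop ∧ (∀ k, 0 < mh k) ∧ 0 < K ∧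
        (∀ A B : YMSpecies G, ∃ C : ℝ, ∀ k S n : ℕ, S₁ k ≤ S → n ≤ S →
          |latticeConnectedCorr r.ρ (β k) (2 * S + 1) A.F B.F n| ≤ C * Real.exp (-(mh k * n))) ∧
        (∀ k S₀ : ℕ, ∃ A B : YMSpecies G, ∀ C : ℝ, ∃ S n : ℕ, S₀ ≤ S ∧ n ≤ S ∧
          C * Real.exp (-(K * mh k * n)) < |latticeConnectedCorr r.ρ (β k) (2 * S + 1) A.F B.F n|)) := by
  obtain ⟨β, mh, S₁, K, h1, h2, h3, h4, h5⟩ := stub_lockOfRpCore hXi G hG r hGap (stub_rpCore G r)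
  exact ⟨β, mh, S₁, K, h1, h2, h3, h4, h5⟩

/-! ## (ii) The lattice gap of a scheme on locked data -/

/-- (GAP) for a scheme built on locked data is bookkeeping: the UNIFORM constants transported along `φ`, the
thresholds below `L_k`, the unit `Δ₀ a_k ≤ m̂_{φ k}` (landed `hasLatticeMassGap_of_uniformClustering`). [folklore] -/
theorem cclgSplit_gap_of_locked (r : LatticeRep G) {β : ℕ → ℝ} {mh : ℕ → ℝ} {S₁ : ℕ → ℕ}
    (hunif : (∀ A B : YMSpecies G, ∃ C : ℝ, ∀ k S n : ℕ, S₁ k ≤ S → n ≤ S →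
        |latticeConnectedCorr r.ρ (β k) (2 * S + 1) A.F B.F n| ≤ C * Real.exp (-(mh k * n))))
    {sch : SpeciesScheme (YMSpecies G)} {φ : ℕ → ℕ} {Δ₀ : ℝ}
    (hβ : ∀ k, sch.β k = β (φ k)) (ha : ∀ k, Δ₀ * sch.a k ≤ mh (φ k))
    (hLk : ∀ k, S₁ (φ k) ≤ sch.L k) : HasLatticeMassGap r sch Δ₀ := by
  refine hasLatticeMassGap_of_uniformClustering r sch Δ₀ (fun k => mh (φ k)) (Eventually.of_forall ha) fun A B => ?_
  obtain ⟨C, hC⟩ := hunif A B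
  refine ⟨C, Eventually.of_forall fun k S hS n hn => ?_⟩
  rw [hβ k]
  exact hC (φ k) S n ((hLk k).trans hS) hn

/-- The lattice gap is monotone in the rate. [folklore] -/
theorem cclgSplit_hasLatticeMassGap_mono (r : LatticeRep G) (sch : SpeciesScheme (YMSpecies G)) {Δ Δ' : ℝ}
    (hΔ : Δ' ≤ Δ) (h : HasLatticeMassGap r sch Δ) : HasLatticeMassGap r sch Δ' := by
  intro A B
  obtain ⟨C, hC⟩ := h A B
  refine ⟨max C 0, hC.mono fun k hk S hS n hn => (hk S hS n hn).trans ?_⟩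
  have h1 : Real.exp (-(Δ * (sch.a k * n))) ≤ Real.exp (-(Δ' * (sch.a k * n))) :=
    Real.exp_le_exp.2 (neg_le_neg (mul_le_mul_of_nonneg_right hΔ
      (mul_nonneg (sch.a_pos k).le (Nat.cast_nonneg n))))
  calc C * Real.exp (-(Δ * (sch.a k * n))) ≤ max C 0 * Real.exp (-(Δ * (sch.a k * n))) :=
        mul_le_mul_of_nonneg_right (le_max_left _ _) (Real.exp_pos _).le
    _ ≤ max C 0 * Real.exp (-(Δ' * (sch.a k * n))) := mul_le_mul_of_nonneg_left h1 (le_max_right _ _)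

/-- (CSCL) rides along subsequences (every clause of `ClustersCS` is `∀ᶠ k`). [folklore] -/
theorem cclgSplit_hasCSClustering_canon_subScheme (r : LatticeRep G) (sch : SpeciesScheme (YMSpecies G)) (ψ : ℕ → ℕ)
    (hψ : StrictMono ψ) {Δ : ℝ} (h : SpeciesScheme.HasCSClustering r (canon r sch) Δ) :
    SpeciesScheme.HasCSClustering r (canon r (subScheme sch ψ hψ)) Δ := by
  intro n m hn hm σ σ' N N' c c' p q hp hq t ht ε hε
  exact hψ.tendsto_atTop.eventually (h n m hn hm σ σ' N N' c c' p q hp hq t ht ε hε)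

/-- (CSCL) is monotone in the rate (`e^{-Δt} ≤ e^{-Δ't}` for `Δ' ≤ Δ`, `t ≥ 0`). [folklore] -/
theorem cclgSplit_hasCSClustering_mono (r : LatticeRep G) (sch : SpeciesScheme (YMSpecies G)) {Δ Δ' : ℝ}
    (hΔ : Δ' ≤ Δ) (h : SpeciesScheme.HasCSClustering r sch Δ) : SpeciesScheme.HasCSClustering r sch Δ' := by
  intro n m hn hm σ σ' N N' c c' p q hp hq t ht ε hε
  refine (h n m hn hm σ σ' N N' c c' p q hp hq t ht ε hε).mono fun k hk => hk.trans ?_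
  have h1 : Real.exp (-Δ * t) ≤ Real.exp (-Δ' * t) := cclgSplit_exp_mono Δ Δ' t hΔ ht
  gcongr

/-! ## (iii) The skewness floor, frequently, from the NLO skewness window -/

/-- **The skewness floor FREQUENTLY in `k`** for a canonically normalised, exactly centred weak-coupling scheme with
route ParabolicTrajectory's `UVB` and `ND2` and time-axis clustering (CL-t) — from the NLO skewness-window hypothesis
(the registered `stub_skewWindow` verbatim) and its landed first lemma `stub_witness`. [folklore] -/
theorem cclgSplit_ng_of_pinned
    (hSk : (∀ (G : Type) [Group G] [TopologicalSpace G] [IsTopologicalGroup G] [CompactSpace G]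
      [MeasurableSpace G] [BorelSpace G], IsCompactSimpleLieGroup G →
      ∀ (r : LatticeRep G) (sch : SpeciesScheme (YMSpecies G))
        (LS : (k n : ℕ) → SchwartzMap (Fin n → EuclideanSpace ℝ (Fin 4)) ℂ → ℂ),
      (∀ (k n : ℕ) (F : SchwartzMap (Fin n → EuclideanSpace ℝ (Fin 4)) ℂ), LS k n F =
        ∫ U : GaugeConfig 4 (sch.side k) G, ∑ x : Fin n → ↥(box 4 (sch.L k)),
          F (fun i => sch.a k • siteToE ↑(x i)) *
            ∏ i, ((sch.c r.curvature k * sch.a k ^ 4 *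
              (r.curvature.F (configShift (-↑(x i)) (torusLift (sch.side k) U)) - sch.m r.curvature k) : ℝ) : ℂ)
          ∂(wilsonMeasure r.ρ (sch.β k))) →
      Tendsto sch.β atTop atTop →
      (∀ k : ℕ, sch.m r.curvature k =
        ∫ U : GaugeConfig 4 (sch.side k) G, r.curvature.F (torusLift (sch.side k) U) ∂(wilsonMeasure r.ρ (sch.β k))) →
      (∃ (s : ℕ) (α β' : ℝ), ∀ (n : ℕ) (F : SchwartzMap (Fin n → EuclideanSpace ℝ (Fin 4)) ℂ),
        IsOffDiagonal F → ∀ᶠ k in atTop, ‖LS k n F‖ ≤ α * (n.factorial : ℝ) ^ β' * schwartzNorm (n * s) F) →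
      (∃ (f g : SchwartzMap (Fin 1 → EuclideanSpace ℝ (Fin 4)) ℂ)
        (H : SchwartzMap (Fin (1 + 1) → EuclideanSpace ℝ (Fin 4)) ℂ),
        IsTimeOrdered f ∧ IsTimeOrdered g ∧ IsAppendTensorOf H (osAdjoint f) g ∧
          ∃ δ : ℝ, 0 < δ ∧ ∀ᶠ k in atTop, δ ≤ ‖LS k (1 + 1) H‖) →
      (∃ Δ : ℝ, 0 < Δ ∧ ∀ (n m : ℕ) (F : SchwartzMap (Fin n → EuclideanSpace ℝ (Fin 4)) ℂ)
        (G' : SchwartzMap (Fin m → EuclideanSpace ℝ (Fin 4)) ℂ), IsTimeOrdered F → IsTimeOrdered G' →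
        ∃ C : ℝ, ∀ t : ℝ, 0 ≤ t → ∀ᶠ k in atTop,
          ∀ H : SchwartzMap (Fin (n + m) → EuclideanSpace ℝ (Fin 4)) ℂ,
            IsAppendTensorOf H (osAdjoint F) (translateMulti (EuclideanSpace.single 0 t) G') →
              ‖LS k (n + m) H - LS k n (osAdjoint F) * LS k m G'‖ ≤ C * Real.exp (-Δ * t)) →
      ∃ (s₃ : ℂ) (φ : ℕ → ℕ) (f g h : ℕ → SchwartzMap (EuclideanSpace ℝ (Fin 4)) ℂ)
        (F₃ : ℕ → SchwartzMap (Fin 3 → EuclideanSpace ℝ (Fin 4)) ℂ) (w : ℕ → ℝ),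
        s₃ ≠ 0 ∧ StrictMono φ ∧ (∀ j, 0 < w j) ∧
          (∀ j, IsTensorOf (F₃ j) ![f j, g j, h j] ∧ IsOffDiagonal (F₃ j)) ∧
          ∀ ε : ℝ, 0 < ε → ∀ᶠ j in atTop, ∀ᶠ k in atTop, ‖LS (φ k) 3 (F₃ j) / (w j : ℂ) - s₃‖ ≤ ε))
    (hG : IsCompactSimpleLieGroup G) (r : LatticeRep G) (sch : SpeciesScheme (YMSpecies G))
    (hAF : Tendsto sch.β atTop atTop) (hCAN : (∀ k : ℕ, sch.c r.curvature k = (sch.a k ^ 4)⁻¹)) (hVS : (∀ k : ℕ, sch.m r.curvature k =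
        ∫ U : GaugeConfig 4 (sch.side k) G, r.curvature.F (torusLift (sch.side k) U) ∂(wilsonMeasure r.ρ (sch.β k))))
    (hUVB : PT_UVB r sch) (hND : ND2 r sch)
    (hCLt : (∃ Δ : ℝ, 0 < Δ ∧ ∀ (n m : ℕ) (F : SchwartzMap (Fin n → EuclideanSpace ℝ (Fin 4)) ℂ)
        (G' : SchwartzMap (Fin m → EuclideanSpace ℝ (Fin 4)) ℂ), IsTimeOrdered F → IsTimeOrdered G' →
        ∃ C : ℝ, ∀ t : ℝ, 0 ≤ t → ∀ᶠ k in atTop,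
          ∀ H : SchwartzMap (Fin (n + m) → EuclideanSpace ℝ (Fin 4)) ℂ,
            IsAppendTensorOf H (osAdjoint F) (translateMulti (EuclideanSpace.single 0 t) G') →
              ‖curvDistribution r sch k (n + m) H - curvDistribution r sch k n (osAdjoint F) *
                curvDistribution r sch k m G'‖ ≤ C * Real.exp (-Δ * t))) :
    (∃ (f g h : SchwartzMap (EuclideanSpace ℝ (Fin 4)) ℂ) (F₃ : SchwartzMap (Fin 3 → EuclideanSpace ℝ (Fin 4)) ℂ),
        IsTensorOf F₃ ![f, g, h] ∧ IsOffDiagonal F₃ ∧ ∃ δ : ℝ, 0 < δ ∧ ∃ᶠ k in atTop, δ ≤ ‖curvDistribution r sch k 3 F₃‖) := by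
  have hEQ : (∀ (k n : ℕ) (F : SchwartzMap (Fin n → EuclideanSpace ℝ (Fin 4)) ℂ), curvDistribution r sch k n F =
        ∫ U : GaugeConfig 4 (sch.side k) G, ∑ x : Fin n → ↥(box 4 (sch.L k)),
          F (fun i => sch.a k • siteToE ↑(x i)) *
            ∏ i, ((sch.c r.curvature k * sch.a k ^ 4 *
              (r.curvature.F (configShift (-↑(x i)) (torusLift (sch.side k) U)) - sch.m r.curvature k) : ℝ) : ℂ)
          ∂(wilsonMeasure r.ρ (sch.β k))) := fun k n F =>
    (lsk_eq_curvDistribution r sch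
      (fun (k n : ℕ) (F : SchwartzMap (Fin n → EuclideanSpace ℝ (Fin 4)) ℂ) =>
          ∫ U : GaugeConfig 4 (sch.side k) G, ∑ x : Fin n → ↥(box 4 (sch.L k)),
            F (fun i => sch.a k • siteToE ↑(x i)) *
              ∏ i, ((sch.c r.curvature k * sch.a k ^ 4 *
                (r.curvature.F (configShift (-↑(x i)) (torusLift (sch.side k) U)) - sch.m r.curvature k) : ℝ) : ℂ)
            ∂(wilsonMeasure r.ρ (sch.β k)))
      (fun _ _ _ => rfl) hCAN hVS k n F).symm
  obtain ⟨s₃, φ, f, g, h, F₃, w, hs₃, hφ, hw, hF, hwin⟩ :=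
    hSk G hG r sch (curvDistribution r sch) hEQ hAF hVS hUVB hND hCLt
  obtain ⟨f₀, g₀, h₀, F₀, hT, hO, δ, hδ, hfreq⟩ :=
    stub_witness (fun k F => curvDistribution r sch (φ k) 3 F) ⟨s₃, f, g, h, F₃, w, hs₃, hw, hF, hwin⟩
  exact ⟨f₀, g₀, h₀, F₀, hT, hO, δ, hδ, hφ.tendsto_atTop.frequently hfreq⟩

/-! ## (iv) Sub-schemes: route ParabolicTrajectory's one-field inputs ride along strictly increasing reindexings -/

/-- **Route ParabolicTrajectory's one-field inputs along a sub-scheme.** For a weak-coupling scheme with `UUVB`,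
`ND2`, `UCL`, `AsympTransl`, `AsympRot` and ANY strictly increasing `ψ`: `UVB`, `ARP` (PT's landed `uvb_of_uuvb`,
`stub_arp`, `torusSlabRP_of_tendsto`), `ND2`, `UCL` and `AsympEuclid` hold for `subScheme sch ψ` — every clause is
`∀ᶠ k` / `Tendsto` and `curvDistribution` of the sub-scheme is `curvDistribution` along `ψ`. [folklore] -/
theorem cclgSplit_pt_package_subScheme (r : LatticeRep G) (sch : SpeciesScheme (YMSpecies G))
    (hAF : Tendsto sch.β atTop atTop) (hUU : UUVB r sch) (hND : ND2 r sch) (hUCL : UCL r sch)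
    (hEUC : AsympTransl r sch) (hROT : AsympRot r sch) (ψ : ℕ → ℕ) (hψ : StrictMono ψ) :
    PT_UVB r (subScheme sch ψ hψ) ∧ PT_ARP r (subScheme sch ψ hψ) ∧ ND2 r (subScheme sch ψ hψ) ∧
      UCL r (subScheme sch ψ hψ) ∧ AsympEuclid r (subScheme sch ψ hψ) := by
  have hUU2 : UUVB r (subScheme sch ψ hψ) := by
    obtain ⟨s, α, β', h⟩ := hUU
    exact ⟨s, α, β', hψ.tendsto_atTop.eventually h⟩
  have hUVB2 : PT_UVB r (subScheme sch ψ hψ) :=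
    Summit.QuantumFields.YangMills.Cruxes.ContinuumLimitOnTrajectory.TwoOrbitSynchronisation.uvb_of_uuvb r _ hUU2
  have hAF2 : Tendsto (subScheme sch ψ hψ).β atTop atTop := hAF.comp hψ.tendsto_atTop
  have hARP2 : PT_ARP r (subScheme sch ψ hψ) :=
    Summit.QuantumFields.YangMills.Cruxes.ContinuumLimitOnTrajectory.TwoOrbitSynchronisation.stub_arp G r _
      (torusSlabRP_of_tendsto r _ hAF2) hUU2 hUVB2
  refine ⟨hUVB2, hARP2, ?_, ?_, ?_, ?_⟩
  · obtain ⟨f, g, H, hf, hg, hH, δ, hδ, hev⟩ := hND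
    exact ⟨f, g, H, hf, hg, hH, δ, hδ, hψ.tendsto_atTop.eventually hev⟩
  · intro n m F G' hF hG' a ha0 ha ε hε
    obtain ⟨t₀, ht₀⟩ := hUCL n m F G' hF hG' a ha0 ha ε hε
    exact ⟨t₀, fun t ht H hH => hψ.tendsto_atTop.eventually (ht₀ t ht H hH)⟩
  · intro p F hF a
    exact (hEUC p F hF a).comp hψ.tendsto_atTop
  · intro p F hF R hR
    exact (hROT p F hF R hR).comp hψ.tendsto_atTop

end Summit.QuantumFields.YangMills.Theorems.ContinuumLegGivenGap

end
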